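import Summits.HubbardSuperconductivity.HubbardSuperconductivity.Theorems.LevyLogBootstrapBlock2InfDivXXZLevyReduction
import Literature.Analysis.Matrix.ReciprocalNegDefKernel
import HarnessLib

/-!
# Crux `Block2InfDivXXZ` (stmt-HubbardSuperconductivity-15048, route `LevyLogBootstrap`):
# the RECIPROCAL criterion — negative type of `1/K₂` implies infinite divisibility of `K₂`

Support file for the crux `Block2InfDivXXZ` (infinite divisibility of the 2×2-block transverse
kernel `K₂` of every normalised `S^z_tot = 0` sector ground state of
`H_M(Δ) = xxzHamiltonian 1 (torusGraph 2 M) (-1) Δ`, even `M ≥ 4`, `Δ ∈ [-1, 0]`).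

By Berg–Christensen–Ressel (1984) Ch. 3 Thm. 2.3 / Exercise 2.21 (tree:
`Literature.Analysis.Matrix.isNegDefKernel_negLog_of_inv_isNegDefKernel`), a pointwise positive
kernel whose RECIPROCAL is a negative definite kernel has `-log` of negative type, hence is
infinitely divisible. This gives a second, strictly stronger but LINEAR-IN-`1/K₂` sufficient
condition for the crux, beside the Lévy form `ν_q ≥ 0` of `…LevyReduction.lean`:

* `blockRecipNegType_of_recipFourier_nonpos` — on the coarse torus `(ℤ/(M/2))²`: if for every
  nonzero coarse momentum `q` the cosine transform of the reciprocal coarse block kernel is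
  nonpositive, `Σ_X (1/k₂(X)) Re χ_q(X) ≤ 0`, then `(x, y) ↦ 1/K₂(x, y)` is a negative definite
  kernel (Bochner on the finite torus, negative-type form, through the block map);
* `Block2InfDivXXZ_of_blockRecipNegType` — negative type of `1/K₂` for all `(M, Δ, ψ)` ⇒ the crux;
* `Block2InfDivXXZ_of_recipFourier_nonpos` — the assembled Fourier form.

Numerical status of the hypothesis (prover evidence on the item, 2026-08-17, file
`ANALYSIS-w5-expansion.md`): the reciprocal cosine transforms are ≤ 0 at every nonzero coarse
mode for all held kernels (exact 4×4 at Δ = -1, -0.5, 0; SSE QMC M = 6–24 at Δ = -1; M = 8, 12 on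
a Δ-grid) and for the 2×2-blocked linear-spin-wave law (M ≤ 64); the normalised margin is
comfortable for Δ ≥ -0.9 and for 4×4 blocks, but tends to 0⁺ with M at (b = 2, Δ = -1), so this
criterion is a candidate route to the crux AWAY from the SU(2) point only. No definition is
introduced; sorry-free.
-/

noncomputable section

set_option linter.dupNamespace false

namespace Summit.HubbardSuperconductivity.HubbardSuperconductivity.Theorems.LevyLogBootstrap

open scoped BigOperators Matrix ComplexOrder ComplexConjugate
open Matrix Finset Complex
open Literature.MathematicalPhysics.QuantumLattice Literature.Probability.LatticeModels
open Literature.Analysis.Matrix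

/-- **Reciprocal Fourier criterion ⇒ negative type of `1/K₂`.** For even `M ≥ 4`, `Δ ∈ [-1, 0]`
and a normalised `S^z_tot = 0` sector ground state `ψ` of `H_M(Δ)`: if for every nonzero coarse
momentum `q ∈ (ℤ/(M/2))²` the cosine transform of the reciprocal coarse block kernel is nonpositive,
`Σ_X k₂(X)⁻¹ · Re χ_q(X) ≤ 0` (`k₂(X) = Σ_{⌊x'/2⌋ = X, ⌊y'/2⌋ = 0} Re⟨ψ, S⁺_{x'} S⁻_{y'} ψ⟩ > 0`),
then the fine-indexed kernel `(x, y) ↦ K₂(x, y)⁻¹` is negative definite. Proof: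
`K₂(x, y) = k₂(β x - β y)` (`block2Kernel_eq_coarse`), `k₂` even (`coarseKernel_neg`), Bochner on
the finite torus in negative-type form (`isNegDefKernel_neg_of_factor_torus`) applied to
`f = -1/k₂`. [folklore] -/
theorem blockRecipNegType_of_recipFourier_nonpos (M : ℕ) [NeZero M] [NeZero (M / 2)]
    (hEven : Even M) (Δ : ℝ) (ψ : TensorIndex (TorusSite 2 M) 2 → ℂ)
    (hψ : ψ ∈ @spinZSector (TorusSite 2 M) _ _ 1 0) (hnorm : star ψ ⬝ᵥ ψ = 1)
    (heig : Matrix.mulVec (xxzHamiltonian 1 (torusGraph 2 M) (-1) Δ) ψ =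
      ((lowestEnergyInSector 1 (xxzHamiltonian 1 (torusGraph 2 M) (-1) Δ) 0 : ℝ) : ℂ) • ψ)
    (hrec : ∀ q : TorusSite 2 (M / 2), q ≠ 0 →
      ∑ X : TorusSite 2 (M / 2), (∑ x' : TorusSite 2 M, ∑ y' : TorusSite 2 M,
          if (∀ i : Fin 2, (x' i).val / 2 = (X i).val) ∧ (∀ i : Fin 2, (y' i).val / 2 = 0) then
            (star ψ ⬝ᵥ Matrix.mulVec
              (onSite x' (spinRaise 1) * onSite y' (spinLower 1)) ψ).re
          else 0)⁻¹ * (torusChar q X).re ≤ 0) :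
    IsNegDefKernel fun x y : TorusSite 2 M =>
      (∑ x' : TorusSite 2 M, ∑ y' : TorusSite 2 M,
        if (∀ i : Fin 2, (x' i).val / 2 = (x i).val / 2) ∧
            (∀ i : Fin 2, (y' i).val / 2 = (y i).val / 2) then
          (star ψ ⬝ᵥ Matrix.mulVec
            (onSite x' (spinRaise 1) * onSite y' (spinLower 1)) ψ).re
        else 0)⁻¹ := by
  have hM : M = 2 * (M / 2) := (Nat.two_mul_div_two_of_even hEven).symm
  set k₂ : TorusSite 2 (M / 2) → ℝ := fun X => ∑ x' : TorusSite 2 M, ∑ y' : TorusSite 2 M,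
      if (∀ i : Fin 2, (x' i).val / 2 = (X i).val) ∧ (∀ i : Fin 2, (y' i).val / 2 = 0) then
        (star ψ ⬝ᵥ Matrix.mulVec (onSite x' (spinRaise 1) * onSite y' (spinLower 1)) ψ).re
      else 0 with hk₂
  set K₂ : TorusSite 2 M → TorusSite 2 M → ℝ := fun x y => ∑ x' : TorusSite 2 M,
      ∑ y' : TorusSite 2 M,
        if (∀ i : Fin 2, (x' i).val / 2 = (x i).val / 2) ∧
            (∀ i : Fin 2, (y' i).val / 2 = (y i).val / 2) then
          (star ψ ⬝ᵥ Matrix.mulVec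
            (onSite x' (spinRaise 1) * onSite y' (spinLower 1)) ψ).re
        else 0 with hK₂
  have h := isNegDefKernel_neg_of_factor_torus (d := 2) (L := M / 2) (fun x y => -(K₂ x y)⁻¹)
    (fun x : TorusSite 2 M => fun i : Fin 2 => (((x i).val / 2 : ℕ) : ZMod (M / 2)))
    (fun X => -(k₂ X)⁻¹) (fun x y => ?_) (fun X => ?_) (fun q hq => ?_)
  · have e : (fun x y : TorusSite 2 M => -(-(K₂ x y)⁻¹)) = fun x y => (K₂ x y)⁻¹ := by
      funext x y
      rw [neg_neg]
    rw [e] at h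
    exact h
  · -- factorisation through the coarse torus
    simp only [hK₂, hk₂]
    rw [block2Kernel_eq_coarse M hM hEven Δ ψ hψ hnorm heig x y]
  · -- evenness
    simp only [hk₂]
    rw [coarseKernel_neg M hM hEven Δ ψ hψ hnorm heig X]
  · -- sign of the cosine transform
    have e : ∑ X : TorusSite 2 (M / 2), -(k₂ X)⁻¹ * (torusChar q X).re =
        -∑ X : TorusSite 2 (M / 2), (k₂ X)⁻¹ * (torusChar q X).re := by
      rw [← Finset.sum_neg_distrib]
      exact Finset.sum_congr rfl fun X _ => by ring
    rw [e, neg_nonneg]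
    exact hrec q hq

/-- **Negative type of the reciprocal block kernel implies the crux `Block2InfDivXXZ`.** If for
every even `M ≥ 4`, `Δ ∈ [-1, 0]` and every normalised `S^z_tot = 0` sector ground state `ψ` of
`H_M(Δ)` the kernel `(x, y) ↦ 1/K₂(x, y)` (reciprocal of the fine-indexed 2×2-block transverse
kernel of the crux) is negative definite, then every fractional Hadamard power of `K₂` is positive
semidefinite: `K₂ > 0` (`block2Kernel_pos`), `-log K₂` negative definite by the reciprocal
criterion of Berg–Christensen–Ressel Ch. 3 Thm. 2.3 / Ex. 2.21
(`isNegDefKernel_negLog_of_inv_isNegDefKernel`), Schoenberg (`posSemidef_rpow_of_negLogType`).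
[folklore] -/
theorem Block2InfDivXXZ_of_blockRecipNegType :
    (∀ (M : ℕ) [NeZero M], Even M → 4 ≤ M → ∀ Δ ∈ Set.Icc (-1:ℝ) 0, ∀ (ψ :
      Literature.MathematicalPhysics.QuantumLattice.TensorIndex
      (Literature.Probability.LatticeModels.TorusSite 2 M) 2 → ℂ), ψ ∈
      @Literature.MathematicalPhysics.QuantumLattice.spinZSector
      (Literature.Probability.LatticeModels.TorusSite 2 M) _ _ 1 0 → star ψ ⬝ᵥ ψ = 1 → Matrix.mulVec
      (Literature.MathematicalPhysics.QuantumLattice.xxzHamiltonian 1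
      (Literature.Probability.LatticeModels.torusGraph 2 M) (-1) Δ) ψ =
      ((Literature.MathematicalPhysics.QuantumLattice.lowestEnergyInSector 1
      (Literature.MathematicalPhysics.QuantumLattice.xxzHamiltonian 1
      (Literature.Probability.LatticeModels.torusGraph 2 M) (-1) Δ) 0 : ℝ) : ℂ) • ψ →
      Literature.Analysis.Matrix.IsNegDefKernel fun x y :
      Literature.Probability.LatticeModels.TorusSite 2 M => (∑ x' :
      Literature.Probability.LatticeModels.TorusSite 2 M, ∑ y' :
      Literature.Probability.LatticeModels.TorusSite 2 M, if (∀ i : Fin 2, (x' i).val / 2 = (x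
      i).val / 2) ∧ (∀ i : Fin 2, (y' i).val / 2 = (y i).val / 2) then (star ψ ⬝ᵥ Matrix.mulVec
      (Literature.MathematicalPhysics.QuantumLattice.onSite x'
      (Literature.MathematicalPhysics.QuantumLattice.spinRaise 1) *
      Literature.MathematicalPhysics.QuantumLattice.onSite y'
      (Literature.MathematicalPhysics.QuantumLattice.spinLower 1)) ψ).re else 0)⁻¹) →
      Summit.HubbardSuperconductivity.HubbardSuperconductivity.Theses.LevyLogBootstrap.Block2InfDivXXZ := by
  intro hrec M _ hEven h4 Δ hΔ ψ hψ hnorm heig s hs _hs1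
  have hpos := block2Kernel_pos M hEven h4 Δ hΔ ψ hψ hnorm heig
  exact posSemidef_rpow_of_negLogType _ hpos
    (isNegDefKernel_negLog_of_inv_isNegDefKernel hpos (hrec M hEven h4 Δ hΔ ψ hψ hnorm heig)) s hs

/-- **Reciprocal Fourier criterion ⇒ the crux `Block2InfDivXXZ`** (assembled form): if for every
even `M ≥ 4`, `Δ ∈ [-1, 0]`, every normalised `S^z_tot = 0` sector ground state `ψ` of `H_M(Δ)` and
every nonzero coarse momentum `q ∈ (ℤ/(M/2))²` the cosine transform of the reciprocal coarse block
kernel is nonpositive, `Σ_X k₂(X)⁻¹ Re χ_q(X) ≤ 0`, then the 2×2-block transverse kernel is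
infinitely divisible (`blockRecipNegType_of_recipFourier_nonpos` +
`Block2InfDivXXZ_of_blockRecipNegType`). This is the finite family of LINEAR sign conditions on
`1/k₂` tested numerically in the prover's evidence note (2026-08-17). [folklore] -/
theorem Block2InfDivXXZ_of_recipFourier_nonpos :
    (∀ (M : ℕ) [NeZero M] [NeZero (M / 2)], Even M → 4 ≤ M → ∀ Δ ∈ Set.Icc (-1:ℝ) 0, ∀ (ψ :
      Literature.MathematicalPhysics.QuantumLattice.TensorIndex
      (Literature.Probability.LatticeModels.TorusSite 2 M) 2 → ℂ), ψ ∈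
      @Literature.MathematicalPhysics.QuantumLattice.spinZSector
      (Literature.Probability.LatticeModels.TorusSite 2 M) _ _ 1 0 → star ψ ⬝ᵥ ψ = 1 → Matrix.mulVec
      (Literature.MathematicalPhysics.QuantumLattice.xxzHamiltonian 1
      (Literature.Probability.LatticeModels.torusGraph 2 M) (-1) Δ) ψ =
      ((Literature.MathematicalPhysics.QuantumLattice.lowestEnergyInSector 1
      (Literature.MathematicalPhysics.QuantumLattice.xxzHamiltonian 1
      (Literature.Probability.LatticeModels.torusGraph 2 M) (-1) Δ) 0 : ℝ) : ℂ) • ψ → ∀ q :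
      Literature.Probability.LatticeModels.TorusSite 2 (M / 2), q ≠ 0 → ∑ X :
      Literature.Probability.LatticeModels.TorusSite 2 (M / 2), (∑ x' :
      Literature.Probability.LatticeModels.TorusSite 2 M, ∑ y' :
      Literature.Probability.LatticeModels.TorusSite 2 M, if (∀ i : Fin 2, (x' i).val / 2 = (X
      i).val) ∧ (∀ i : Fin 2, (y' i).val / 2 = 0) then (star ψ ⬝ᵥ Matrix.mulVec
      (Literature.MathematicalPhysics.QuantumLattice.onSite x'
      (Literature.MathematicalPhysics.QuantumLattice.spinRaise 1) *
      Literature.MathematicalPhysics.QuantumLattice.onSite y'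
      (Literature.MathematicalPhysics.QuantumLattice.spinLower 1)) ψ).re else 0)⁻¹ *
      (Literature.Probability.LatticeModels.torusChar q X).re ≤ 0) →
      Summit.HubbardSuperconductivity.HubbardSuperconductivity.Theses.LevyLogBootstrap.Block2InfDivXXZ := by
  intro hrec
  refine Block2InfDivXXZ_of_blockRecipNegType fun M _ hEven h4 Δ hΔ ψ hψ hnorm heig => ?_
  haveI : NeZero (M / 2) := ⟨by omega⟩
  exact blockRecipNegType_of_recipFourier_nonpos M hEven Δ ψ hψ hnorm heig
    (hrec M hEven h4 Δ hΔ ψ hψ hnorm heig)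

end Summit.HubbardSuperconductivity.HubbardSuperconductivity.Theorems.LevyLogBootstrap

end
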